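import Literature.AlgebraicGeometry.Resolution.PrimeDivisorIdeals
import Literature.AlgebraicGeometry.Resolution.CurveBlowupDeltaDrop
import Mathlib.RingTheory.Length
import HarnessLib

/-!
# [OURS · L1 W4.6 rung (ii), dimension ladder] THE TERMINATION MEASURE OF THE SURFACE LOOP
# (definitions; brick B10b-defs of rung (ii-2) `GammaFreeGlobalOrderReductionDimLE p 2`)

Cell res-hironaka, LADDER-RESOLUTION rung L (D-0089), slot W4.6, rung (ii) (dimension ladder, res-L1-type-o1 p496755); seat
res-D-pv-049 AS res-L1-s46-pv-11 (holder of rung (ii-2); architecture v2, STATUS 2026-08-27T05:4xZ). Host route MarkedTransfer,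
host item `HypersurfaceOrderReductionDimLeThree` (stmt-ResolutionOfSingularities-16156); proposed `--kind definition --supports`
it `--as helper`. PROOF DEVICES ONLY (no object of the manuscript [Hironaka2017] is modelled; nothing of it is asserted): the
three components of the lexicographic termination measure `(Δ, Σ(i−1), Σ(k−2)⁺)` of the `d = 2` loop «blow up a non-snc point of
`Sing(J, m)`», written for a FAMILY `ζ : ι → Y` of codimension-one points (the prime divisors of `V(J)`, brick B10a) and a family
`C : ι → Scheme` of integral curves presenting them. AI-written; AI review is weaker than expert review.

* `pairLength ζ₁ ζ₂ y` — the local intersection number `i_y(cl ζ₁, cl ζ₂) = λ(𝒪_{Y,y}/(𝔭_{ζ₁} + 𝔭_{ζ₂}))` (an `ℕ∞`; Hartshorne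
  V §1: `(C.D)_P = length 𝒪_P/(f, g)`), DEF-FREE in the branches: the ideals are the stalks of the prime-divisor ideal sheaves.
* `pairTangencyAt ζ k l y` — `(i_y − 1)` if both branches `k`, `l` pass through `y` (and are not `y`), else `0` (an `ℕ`).
* `pairTangency ζ k l = Σ_y pairTangencyAt`, `familyTangency ζ = Σ_{k ≠ l} pairTangency` — the second component `Σ(i−1)`.
* `branchCount ζ y = #{k | ζ k ⤳ y, ζ k ≠ y}`, `familyExcess ζ = Σ_y (branchCount − 2)` — the third component `Σ(k−2)⁺`.
* `familyDelta C = Σ_k Σ_c δ(𝒪_{C_k,c})` — the first component `Δ` (tree `pointDelta`, Kollár §1.4).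

## Sources

* R. Hartshorne, *Algebraic Geometry* (1977), Ch. V §1, §3 (Thm. 3.9: embedded resolution of curves in surfaces via
  multiplicities / intersection numbers). [Hartshorne1977]
* J. Kollár, *Lectures on Resolution of Singularities* (2007), §1.4 (`δ`-invariant), Thm. 1.47. [Kollar2007]
* H. Hironaka, ms. 2017-03-23, Def. 2.1 p.5 — scope only, under adjudication, not cited as fact. [Hironaka2017]
-/

noncomputable section

set_option linter.dupNamespace false -- mandated namespace of this single-conjunct summit

open CategoryTheory AlgebraicGeometry TopologicalSpace IsLocalRing Topology

namespace Summit.ResolutionOfSingularities.ResolutionOfSingularities.Theorems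

namespace CampaignW46

open Literature.AlgebraicGeometry.Resolution
open Scheme.IdealSheafData

universe u

variable {Y : Scheme.{u}} {ι : Type}

/-- **Local intersection number of two branches** `cl ζ₁`, `cl ζ₂` at `y`: `λ(𝒪_{Y,y}/(𝔭_{ζ₁} + 𝔭_{ζ₂}))`, the length
of the quotient of the local ring by the sum of the stalks of the two prime-divisor ideal sheaves (`ℕ∞`; `∞` e.g. when
`ζ₁ = ζ₂`). A proof device. [cite: Hartshorne1977, Ch. V §1] -/
def pairLength (ζ₁ ζ₂ y : Y) : ℕ∞ :=
  Module.length (Y.presheaf.stalk y)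
    (Y.presheaf.stalk y ⧸ (stalkIdeal (primeDivisorIdeal ζ₁) y ⊔ stalkIdeal (primeDivisorIdeal ζ₂) y))

/-- `pairLength` is symmetric. [folklore] -/
theorem pairLength_comm (ζ₁ ζ₂ y : Y) : pairLength ζ₁ ζ₂ y = pairLength ζ₂ ζ₁ y := by
  unfold pairLength
  rw [sup_comm]

/-- **Tangency excess of the pair of branches `k`, `l` at `y`**: `i_y(k, l) − 1` when both branches pass through `y`
(`ζ k ⤳ y`, `ζ l ⤳ y`, neither equal to `y`), and `0` otherwise (`ℕ`, truncated subtraction; an infinite `i_y` counts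
as `0`). A proof device. [cite: Hartshorne1977, Ch. V Thm. 3.9] -/
def pairTangencyAt (ζ : ι → Y) (k l : ι) (y : Y) : ℕ :=
  ∑ᶠ (_ : ζ k ⤳ y ∧ ζ k ≠ y ∧ ζ l ⤳ y ∧ ζ l ≠ y), ((pairLength (ζ k) (ζ l) y).toNat - 1)

/-- Value of `pairTangencyAt` when both branches pass through `y`. [folklore] -/
theorem pairTangencyAt_of_through {ζ : ι → Y} {k l : ι} {y : Y} (h : ζ k ⤳ y ∧ ζ k ≠ y ∧ ζ l ⤳ y ∧ ζ l ≠ y) :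
    pairTangencyAt ζ k l y = (pairLength (ζ k) (ζ l) y).toNat - 1 := by
  classical
  unfold pairTangencyAt
  rw [finsum_eq_if, if_pos h]

/-- Value of `pairTangencyAt` when one of the branches misses `y`. [folklore] -/
theorem pairTangencyAt_of_not_through {ζ : ι → Y} {k l : ι} {y : Y}
    (h : ¬ (ζ k ⤳ y ∧ ζ k ≠ y ∧ ζ l ⤳ y ∧ ζ l ≠ y)) : pairTangencyAt ζ k l y = 0 := by
  classical
  unfold pairTangencyAt
  rw [finsum_eq_if, if_neg h]

/-- `pairTangencyAt` is symmetric in the two branches. [folklore] -/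
theorem pairTangencyAt_comm (ζ : ι → Y) (k l : ι) (y : Y) : pairTangencyAt ζ k l y = pairTangencyAt ζ l k y := by
  by_cases h : ζ k ⤳ y ∧ ζ k ≠ y ∧ ζ l ⤳ y ∧ ζ l ≠ y
  · rw [pairTangencyAt_of_through h, pairTangencyAt_of_through ⟨h.2.2.1, h.2.2.2, h.1, h.2.1⟩, pairLength_comm]
  · rw [pairTangencyAt_of_not_through h, pairTangencyAt_of_not_through fun h' => h ⟨h'.2.2.1, h'.2.2.2, h'.1, h'.2.1⟩]

/-- **Total tangency excess of the pair of branches `k`, `l`**: `Σ_y (i_y(k,l) − 1)` over the common points (a `finsum`;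
the relevant supports are finite on the surfaces of the loop). A proof device. [cite: Hartshorne1977, Ch. V Thm. 3.9] -/
def pairTangency (ζ : ι → Y) (k l : ι) : ℕ :=
  ∑ᶠ y, pairTangencyAt ζ k l y

/-- **Second component `Σ(i−1)` of the termination measure**: the sum over ordered pairs of distinct branches of their
total tangency excess. A proof device. [cite: Hartshorne1977, Ch. V Thm. 3.9] -/
def familyTangency (ζ : ι → Y) : ℕ :=
  ∑ᶠ (k : ι) (l : ι) (_ : k ≠ l), pairTangency ζ k l

/-- **Number of branches through `y`**: `#{k | ζ k ⤳ y, ζ k ≠ y}`. A proof device. [folklore] -/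
def branchCount (ζ : ι → Y) (y : Y) : ℕ :=
  Nat.card {k : ι // ζ k ⤳ y ∧ ζ k ≠ y}

/-- **Third component `Σ(k−2)⁺` of the termination measure**: the total excess of the number of branches through a
point over `2` (truncated subtraction in `ℕ`). A proof device. [cite: Hartshorne1977, Ch. V Thm. 3.9] -/
def familyExcess (ζ : ι → Y) : ℕ :=
  ∑ᶠ y, (branchCount ζ y - 2)

/-- **First component `Δ` of the termination measure**: the total `δ`-invariant `Σ_k Σ_c δ(𝒪_{C_k,c})` of a family of
integral curves (tree `pointDelta`). A proof device. [cite: Kollar2007, §1.4] -/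
def familyDelta (C : ι → Scheme.{u}) [∀ k, IsIntegral (C k)] : ℕ∞ :=
  ∑ᶠ k, ∑ᶠ c, pointDelta (C k) c

/-- Unfolding `familyDelta`. [folklore] -/
theorem familyDelta_def (C : ι → Scheme.{u}) [∀ k, IsIntegral (C k)] :
    familyDelta C = ∑ᶠ k, ∑ᶠ c, pointDelta (C k) c := rfl

/-- Unfolding `familyExcess`. [folklore] -/
theorem familyExcess_def (ζ : ι → Y) : familyExcess ζ = ∑ᶠ y, (branchCount ζ y - 2) := rfl

/-- Unfolding `familyTangency`. [folklore] -/
theorem familyTangency_def (ζ : ι → Y) : familyTangency ζ = ∑ᶠ (k : ι) (l : ι) (_ : k ≠ l), pairTangency ζ k l := rfl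

/-- Unfolding `pairTangency`. [folklore] -/
theorem pairTangency_def (ζ : ι → Y) (k l : ι) : pairTangency ζ k l = ∑ᶠ y, pairTangencyAt ζ k l y := rfl

/-- Unfolding `branchCount`. [folklore] -/
theorem branchCount_def (ζ : ι → Y) (y : Y) : branchCount ζ y = Nat.card {k : ι // ζ k ⤳ y ∧ ζ k ≠ y} := rfl

/-- Unfolding `pairLength`. [folklore] -/
theorem pairLength_def (ζ₁ ζ₂ y : Y) : pairLength ζ₁ ζ₂ y = Module.length (Y.presheaf.stalk y)
    (Y.presheaf.stalk y ⧸ (stalkIdeal (primeDivisorIdeal ζ₁) y ⊔ stalkIdeal (primeDivisorIdeal ζ₂) y)) := rfl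

end CampaignW46

end Summit.ResolutionOfSingularities.ResolutionOfSingularities.Theorems

end
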